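import Summits.QuantumFields.BalabanUV.Beta.D1BFx.SortedArrayLimitUniform
import Summits.QuantumFields.BalabanUV.Beta.D1BFx.KCombineCovCombLeg

/-!
# `BalabanUV.Beta.D1BFx.MovingTableSockets` — road «BF-x» for binder row D1, slot (K), chain step (I) «(A1)-PACKED», brick **(B5′)
# «MOVING-TABLE SOCKETS»**: the k-INDEXED-FAMILY («uniform») twins of the COVARIANT organisation's limit sockets — `KLimitGluon.tendsto_hessT_blocksHat_sortK`
# ∕ `tendsto_hessT_NlegRoad`, `KLimitAxial.tendsto_hessT_coDressKInvStep`, `KCombineCov.hessKer_transfer_road_cov_limits`, `KGhostLeg.tendsto_hessT_Cgh`,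
# `KCombineCovCombLeg.tendsto_hessT_Gtau` — over this lineage's landed uniform sockets `TorusArrayLimitUniform` ∕ `SortedArrayLimitUniform` (ruling ρ-g7-8)

HONEST DEPENDENCY (cell records, verbatim): «continuum YM on T⁴ ⇐ BetaPertH ∧ nine spine estimates (0/9 proved); BetaPertH ⇐ (D1) ∧ (D4) ∧
CAP+tail; G-an2-4 gates asym, D1 and NE2/3/4.»  HONEST FRAMING (cell contract, verbatim): «discharging `BetaPertH` makes Bałaban's UV stability
UNCONDITIONAL — a real constructive-QFT result; it is NOT the continuum limit and NOT the Clay problem.»  THIS MODULE DISCHARGES NOTHING of (K),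
of D1 or of the wall: [folklore] re-indexing ∕ one-term instantiations BY NAME over `SortedArrayLimitUniform.tendsto_hessT_sortK_hessKer_of_uniform`,
`TorusArrayLimitUniform.tendsto_hessT_hessKer_of_uniform` (leaf-03 gen 9, p246820 ∕ p246765: Tannery's theorem over `ExpKernelCalculus`' majorants +
TA3b's `s`-free rates), `KLimitGluon.hessT_blocksHat_sortK`, the two legs' sockets (`RWeightedLegPack.spr_NlegRoad` ∕ `shiftK_NlegRoad` ∕
`NlegRoad_inr_row_off` ∕ `NlegRoad_inr_col_off`, `SortedRelInv.spr_decays_pos`; `AxialDressingRooted.decays_coDressKBmAt_KInvStep` ∕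
`shiftK_coDressKBmAt_KInvStep` ∕ `coDressKBmAt_KInvStep_inr_row_off` ∕ `_inr_col_off`, `SortedPack.blockCov_of_neg`), `KGhostLeg.decays_Cgh` ∕ `deltaCgh_pos` ∕
`Cgh_imageShift_mul`, `KCombineCovCombLeg.decays_idK1` ∕ `idK1_imageShift`, `TorusGhostLegs.tendsto_mul_period` and `KCombineCov.eq_of_tendsto_identity₄_eventually`.
No definition, no `def … : Prop`, nothing cited, 0 sorry.  NOT D1, NOT BetaPertH, NOT continuum, NOT Clay.

ABSOLUTE RULE (cell charter, verbatim): «No internally-minted statement may enter as a cited fact. Every hypothesis is either kernel-proved in this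
package or a verbatim quotation of a PUBLISHED theorem with page reference. The manuscript(s) under audit are NOT citable for their own disputed
steps — they are the thing under adjudication; programme-internal (2001/route/tribunal) claims are never citable.»

WHERE THIS SITS (road «BF-x» OWNER `b2b-balaban-beta-d1-p2` g16, LOCATED FINDING F-g16-1 «WRAP», journal l.38370; `A1-PACKED-SPEC.md` v0.3.1 §8).
At SECOND order the torus response packing does not factor through the array of a p-INDEPENDENT `ℤ^D` table: the per-torus identity (B3) holds
EXACTLY with the p-DEPENDENT tables `𝒲^{(p)}` of (B4d) `PeriodicArrayBiSuperposition`, bi-localised UNIFORMLY in `p` («WRAP-UNIFORM») and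
converging ENTRYWISE to the road's table («WRAP-LIMIT», gan24-leaf-05 g50).  The `p → ∞` passage for such k-indexed families is this lineage's
ruling-ρ-g7-8 socket pair `TorusArrayLimitUniform.tendsto_hessT_hessKer_of_uniform` (TA3b currency) ∕ `SortedArrayLimitUniform.tendsto_hessT_sortK_hessKer_of_uniform`
(TB1∕TB2's sorted currency), consumed so far only by the NON-covariant organisation (`KCombine` §4–§5, `TorusScalarCoarseLimit`, `TorusWeightMixed*`).
(B6) «A1-PACKED» re-runs `KCombineCovStripped` §2 — the COVARIANT organisation (R1-L) — whose `ℤ⁴` passage goes through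
`KCombineCov.hessKer_transfer_road_cov_limits` (M-side `KLimitAxial.tendsto_hessT_coDressKInvStep` BY NAME), the N-side `KLimitGluon.tendsto_hessT_NlegRoad`
and the two tower-slot legs `KGhostLeg.tendsto_hessT_Cgh` ∕ `KCombineCovCombLeg.tendsto_hessT_Gtau` — all stated for FIXED table families.  THIS FILE
supplies their k-indexed twins, in the g9 convention: BOTH base-point families k-indexed (`𝒱 k`, `𝒲 k`), (u1) `BiLoc` uniform in `k` at TA3b's tied
points, (u2) entrywise limits `𝒱∞`, `𝒲∞`, conclusions AT THE LIMIT FAMILIES; a fixed family is the constant sequence with `tendsto_const_nhds`.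
§1 `tendsto_hessT_blocksHat_sortK_of_uniform` (`blocksHat` currency); §2 the road's two legs `tendsto_hessT_NlegRoad_of_uniform` (TB5-2a) ∕
`tendsto_hessT_coDressKInvStep_of_uniform` (TB5-2b); §3 the robust combine `hessKer_transfer_road_cov_limits_of_uniform` (per-torus identity
eventually, with the k-th M-tables, ⟹ the `ℤ^{d+1}` identity at the limit families); §4 the tower-slot legs `tendsto_hessT_Cgh_of_uniform` ∕
`tendsto_hessT_Gtau_of_uniform` (for (B5) «GRAM-COV-PACKED» ∕ «FP-PACKED-LIMIT», whose packed second word families wrap like the tables).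
NOT HERE: the uniform sockets themselves (g9, in the tree), «WRAP-LIMIT»∕«WRAP-UNIFORM» (gan24-leaf-05), (B3), (B5), (B6).
Provenance: D1 formalisation swarm leaf seat `b2b-balaban-beta-d1-formalise-leaf-03` gen 21 (road «BF-x» brick (B5′), first-refusal offer of F-g16-1
taken; v1 — a re-derivation of the g9 sockets — withdrawn before filing, ERRATUM E-d1leaf03g21-1), 2026-08-22; no existing file touched.
-/

noncomputable section

namespace Summit.QuantumFields.BalabanUV.Beta.D1BFx.MovingTableSockets

open Matrix Filter Topology
open scoped BigOperators
open Literature.Probability.LatticeModels (TorusSite Torus.proj)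
open Literature.MathematicalPhysics.QuantumFieldTheory.Balaban1983to89
open Literature.MathematicalPhysics.QuantumFieldTheory.Balaban1983to89.Beta
open ExpKernelCalculus (MKer Decays BiLoc hessKer shiftK)
open AffineAveraging (box toSite)
open OneStepResolventKernel (Fib)
open OneStepKernelFamily (KInvStep)
open Summit.QuantumFields.BalabanUV.Beta.TameKernelCalculus (Spr)
open Summit.QuantumFields.BalabanUV.Beta.AxialDressingRooted (coDressKBmAt decays_coDressKBmAt_KInvStep shiftK_coDressKBmAt_KInvStep
  coDressKBmAt_KInvStep_inr_row_off coDressKBmAt_KInvStep_inr_col_off)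
open Summit.QuantumFields.BalabanUV.Beta.D1BFx.FibredPeriodisation (periodiseF)
open Summit.QuantumFields.BalabanUV.Beta.D1BFx.SortedKernels (blocksHat)
open Summit.QuantumFields.BalabanUV.Beta.D1BFx.SortedPack (sortK blockCov_of_neg)
open Summit.QuantumFields.BalabanUV.Beta.D1BFx.SortedRelInv (spr_decays_pos)
open Summit.QuantumFields.BalabanUV.Beta.D1BFx.PeriodicArrays (arr toF)
open Summit.QuantumFields.BalabanUV.Beta.D1BFx.MixedVarPackedHess (hessT)
open Summit.QuantumFields.BalabanUV.Beta.D1BFx.RWeightedLegPack (NlegRoad spr_NlegRoad NlegRoad_inr_row_off NlegRoad_inr_col_off shiftK_NlegRoad)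
open Summit.QuantumFields.BalabanUV.Beta.D1BFx.KLimitGluon (hessT_blocksHat_sortK)
open Summit.QuantumFields.BalabanUV.Beta.D1BFx.TorusGhostLegs (tendsto_mul_period)
open Summit.QuantumFields.BalabanUV.Beta.D1BFx.KGhostLeg (Cgh decays_Cgh deltaCgh_pos Cgh_imageShift_mul)
open Summit.QuantumFields.BalabanUV.Beta.D1BFx.GaugeJetLocal (idK1)
open Summit.QuantumFields.BalabanUV.Beta.D1BFx.KCombineCovCombLeg (decays_idK1 idK1_imageShift)
open Summit.QuantumFields.BalabanUV.Beta.D1BFx.KCombineCov (eq_of_tendsto_identity₄_eventually)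
open Summit.QuantumFields.BalabanUV.Beta.D1BFx.TorusArrayLimitUniform (tendsto_hessT_hessKer_of_uniform)
open Summit.QuantumFields.BalabanUV.Beta.D1BFx.SortedArrayLimitUniform (tendsto_hessT_sortK_hessKer_of_uniform)

variable {D : ℕ} {F : Type*} [Fintype F] {n : ℕ} [NeZero n]

/-! ## §1 The TB5 socket in `blocksHat` currency for k-indexed families (twin of `KLimitGluon.tendsto_hessT_blocksHat_sortK`) -/

/-- [folklore] **THE TB5 SOCKET IN `blocksHat` CURRENCY FOR k-INDEXED FAMILIES**: a leg pack `A` decaying, block covariant and lattice supported in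
its multiplier rows∕columns; k-indexed base-point families `𝒱 k`, `𝒲 k` whose jets `𝒱 k μ 0`, `𝒱 k ν z`, `𝒲 k μ 0 ν z` are bi-localised UNIFORMLY
in `k` and converge ENTRYWISE to `𝒱∞`, `𝒲∞` ⟹
`hessT (blocksHat (p k) (sortK n A); blocksHat (p k) (sortK n (arr (n·p k) (𝒱 k μ 0))), …, blocksHat (p k) (sortK n (arr (n·p k) (𝒲 k μ 0 ν z))))
⟶ hessKer A 𝒱∞ 𝒲∞ μ ν z` (`SortedArrayLimitUniform.tendsto_hessT_sortK_hessKer_of_uniform` re-indexed by `hessT_blocksHat_sortK`). -/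
theorem tendsto_hessT_blocksHat_sortK_of_uniform {A : MKer D (F ⊕ F)} {CA δA : ℝ} (hA : Decays A CA δA) (hδA : 0 < δA)
    (hAcov : ∀ t : Fin D → ℤ, shiftK ((n : ℤ) • t) A = A)
    (hAr : ∀ x y f b, Torus.proj n x ≠ 0 → A x y (Sum.inr f) b = 0) (hAc : ∀ x y a f, Torus.proj n y ≠ 0 → A x y a (Sum.inr f) = 0)
    (𝒱 : ℕ → Fin D → (Fin D → ℤ) → MKer D (F ⊕ F)) (𝒲 : ℕ → Fin D → (Fin D → ℤ) → Fin D → (Fin D → ℤ) → MKer D (F ⊕ F))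
    (𝒱inf : Fin D → (Fin D → ℤ) → MKer D (F ⊕ F)) (𝒲inf : Fin D → (Fin D → ℤ) → Fin D → (Fin D → ℤ) → MKer D (F ⊕ F))
    (μ ν : Fin D) (z : Fin D → ℤ) {P P' Q Q' : Fin D → ℤ} {Cv Cv' C δ : ℝ}
    (hV : ∀ k, BiLoc (𝒱 k μ 0) P P' Cv δ) (hV' : ∀ k, BiLoc (𝒱 k ν z) Q' Q Cv' δ) (hW : ∀ k, BiLoc (𝒲 k μ 0 ν z) P Q C δ) (hδ : 0 < δ)
    (hlimV : ∀ x y a b, Tendsto (fun k => 𝒱 k μ 0 x y a b) atTop (𝓝 (𝒱inf μ 0 x y a b)))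
    (hlimV' : ∀ x y a b, Tendsto (fun k => 𝒱 k ν z x y a b) atTop (𝓝 (𝒱inf ν z x y a b)))
    (hlimW : ∀ x y a b, Tendsto (fun k => 𝒲 k μ 0 ν z x y a b) atTop (𝓝 (𝒲inf μ 0 ν z x y a b)))
    {p : ℕ → ℕ} [∀ k, NeZero (p k)] (hp : Tendsto p atTop atTop) :
    Tendsto (fun k => hessT (blocksHat (p k) (sortK n A))
        (blocksHat (p k) (sortK n (arr (n * p k) (𝒱 k μ 0))))
        (blocksHat (p k) (sortK n (arr (n * p k) (𝒱 k ν z))))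
        (blocksHat (p k) (sortK n (arr (n * p k) (𝒲 k μ 0 ν z)))))
      atTop (𝓝 (hessKer A 𝒱inf 𝒲inf μ ν z)) := by
  simp only [hessT_blocksHat_sortK]
  exact tendsto_hessT_sortK_hessKer_of_uniform hA hδA hAcov hAr hAc 𝒱 𝒲 𝒱inf 𝒲inf μ ν z hV hV' hW hδ hlimV hlimV' hlimW hp

/-! ## §2 The road's two legs for k-indexed families (twins of `KLimitGluon.tendsto_hessT_NlegRoad`, `KLimitAxial.tendsto_hessT_coDressKInvStep`) -/

/-- [folklore] **TB5-2a FOR k-INDEXED FAMILIES — THE N-SIDE (GLUON) LIMIT OF ROUTE T**: for the road's R-weighted leg pack `NlegRoad m a` (spread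
modulo `Spr (Ga (m+1) a)`, block covariant, lattice supported) and k-indexed table families under (u1)+(u2):
`hessT (blocksHat (p k) (sortK (m+1) (NlegRoad m a)); …(𝒱 k μ 0)…, …(𝒱 k ν z)…, …(𝒲 k μ 0 ν z)…) ⟶ hessKer (NlegRoad m a) 𝒱∞ 𝒲∞ μ ν z`. -/
theorem tendsto_hessT_NlegRoad_of_uniform (m : ℕ) {a : ℝ} (hGa : Spr (GluonLeg.Ga (m + 1) a))
    (𝒱 : ℕ → Fin 4 → (Fin 4 → ℤ) → MKer 4 (Fib 3)) (𝒲 : ℕ → Fin 4 → (Fin 4 → ℤ) → Fin 4 → (Fin 4 → ℤ) → MKer 4 (Fib 3))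
    (𝒱inf : Fin 4 → (Fin 4 → ℤ) → MKer 4 (Fib 3)) (𝒲inf : Fin 4 → (Fin 4 → ℤ) → Fin 4 → (Fin 4 → ℤ) → MKer 4 (Fib 3))
    (μ ν : Fin 4) (z : Fin 4 → ℤ) {P P' Q Q' : Fin 4 → ℤ} {Cv Cv' C δ : ℝ}
    (hV : ∀ k, BiLoc (𝒱 k μ 0) P P' Cv δ) (hV' : ∀ k, BiLoc (𝒱 k ν z) Q' Q Cv' δ) (hW : ∀ k, BiLoc (𝒲 k μ 0 ν z) P Q C δ) (hδ : 0 < δ)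
    (hlimV : ∀ x y a' b, Tendsto (fun k => 𝒱 k μ 0 x y a' b) atTop (𝓝 (𝒱inf μ 0 x y a' b)))
    (hlimV' : ∀ x y a' b, Tendsto (fun k => 𝒱 k ν z x y a' b) atTop (𝓝 (𝒱inf ν z x y a' b)))
    (hlimW : ∀ x y a' b, Tendsto (fun k => 𝒲 k μ 0 ν z x y a' b) atTop (𝓝 (𝒲inf μ 0 ν z x y a' b)))
    {p : ℕ → ℕ} [∀ k, NeZero (p k)] (hp : Tendsto p atTop atTop) :
    Tendsto (fun k => hessT (blocksHat (p k) (sortK (m + 1) (NlegRoad m a)))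
        (blocksHat (p k) (sortK (m + 1) (arr ((m + 1) * p k) (𝒱 k μ 0))))
        (blocksHat (p k) (sortK (m + 1) (arr ((m + 1) * p k) (𝒱 k ν z))))
        (blocksHat (p k) (sortK (m + 1) (arr ((m + 1) * p k) (𝒲 k μ 0 ν z)))))
      atTop (𝓝 (hessKer (NlegRoad m a) 𝒱inf 𝒲inf μ ν z)) := by
  obtain ⟨CA, δA, hδA, -, hdec⟩ := spr_decays_pos (spr_NlegRoad m a hGa)
  exact tendsto_hessT_blocksHat_sortK_of_uniform hdec hδA (shiftK_NlegRoad m a)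
    (fun x y f b hx => NlegRoad_inr_row_off m a hx y f b) (fun x y a₀ f hy => NlegRoad_inr_col_off m a x hy a₀ f)
    𝒱 𝒲 𝒱inf 𝒲inf μ ν z hV hV' hW hδ hlimV hlimV' hlimW hp

/-- [folklore] **TB5-2b FOR k-INDEXED FAMILIES — THE M-SIDE (AXIAL-GAUGE LITERAL) LIMIT OF ROUTE T**: for the literal's Π_bm-dressed one-step resolvent
`G = coDressKBmAt (toSite r) n (KInvStep n 0)` (decaying, block covariant, lattice supported — the β cell's sockets BY NAME) and k-indexed table
families under (u1)+(u2) (on the road: first jets the constant family — first order is exact, (B4) — and second tables F-g16-1's `𝒲M^{(p_k)}` with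
their «WRAP-LIMIT»): `hessT (blocksHat (p k) (sortK n G); …) ⟶ hessKer G 𝒱∞ 𝒲∞ μ ν z`. -/
theorem tendsto_hessT_coDressKInvStep_of_uniform {d n : ℕ} [NeZero n] {r : Fin (d + 1) → ℕ} (hr : r ∈ box (d + 1) n)
    (𝒱 : ℕ → Fin (d + 1) → (Fin (d + 1) → ℤ) → MKer (d + 1) (Fib d))
    (𝒲 : ℕ → Fin (d + 1) → (Fin (d + 1) → ℤ) → Fin (d + 1) → (Fin (d + 1) → ℤ) → MKer (d + 1) (Fib d))
    (𝒱inf : Fin (d + 1) → (Fin (d + 1) → ℤ) → MKer (d + 1) (Fib d))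
    (𝒲inf : Fin (d + 1) → (Fin (d + 1) → ℤ) → Fin (d + 1) → (Fin (d + 1) → ℤ) → MKer (d + 1) (Fib d))
    (μ ν : Fin (d + 1)) (z : Fin (d + 1) → ℤ) {P P' Q Q' : Fin (d + 1) → ℤ} {Cv Cv' C δ : ℝ}
    (hV : ∀ k, BiLoc (𝒱 k μ 0) P P' Cv δ) (hV' : ∀ k, BiLoc (𝒱 k ν z) Q' Q Cv' δ) (hW : ∀ k, BiLoc (𝒲 k μ 0 ν z) P Q C δ) (hδ : 0 < δ)
    (hlimV : ∀ x y a b, Tendsto (fun k => 𝒱 k μ 0 x y a b) atTop (𝓝 (𝒱inf μ 0 x y a b)))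
    (hlimV' : ∀ x y a b, Tendsto (fun k => 𝒱 k ν z x y a b) atTop (𝓝 (𝒱inf ν z x y a b)))
    (hlimW : ∀ x y a b, Tendsto (fun k => 𝒲 k μ 0 ν z x y a b) atTop (𝓝 (𝒲inf μ 0 ν z x y a b)))
    {p : ℕ → ℕ} [∀ k, NeZero (p k)] (hp : Tendsto p atTop atTop) :
    Tendsto (fun k => hessT (blocksHat (p k) (sortK n (coDressKBmAt (toSite r) n (KInvStep (d := d) n 0))))
        (blocksHat (p k) (sortK n (arr (n * p k) (𝒱 k μ 0))))
        (blocksHat (p k) (sortK n (arr (n * p k) (𝒱 k ν z))))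
        (blocksHat (p k) (sortK n (arr (n * p k) (𝒲 k μ 0 ν z)))))
      atTop (𝓝 (hessKer (coDressKBmAt (toSite r) n (KInvStep (d := d) n 0)) 𝒱inf 𝒲inf μ ν z)) := by
  obtain ⟨δA, CA, hδA, -, hdec⟩ := decays_coDressKBmAt_KInvStep (d := d) hr 0
  exact tendsto_hessT_blocksHat_sortK_of_uniform hdec hδA (blockCov_of_neg fun t => shiftK_coDressKBmAt_KInvStep (toSite r) 0 t)
    (fun x y f b hx => coDressKBmAt_KInvStep_inr_row_off (toSite r) 0 hx y f b)
    (fun x y a₀ f hy => coDressKBmAt_KInvStep_inr_col_off (toSite r) 0 hy x a₀ f)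
    𝒱 𝒲 𝒱inf 𝒲inf μ ν z hV hV' hW hδ hlimV hlimV' hlimW hp

/-! ## §3 The robust combine of the COVARIANT organisation with k-indexed M-side families (twin of `KCombineCov.hessKer_transfer_road_cov_limits`) -/

/-- [folklore] **«K-TA4G-COMBINE», ROBUST FORM, k-INDEXED M-SIDE FAMILIES**: for the M-side literal `G_M = coDressKBmAt (toSite r) n (KInvStep n 0)`
and k-indexed families `𝒱M k`, `𝒲M k` under (u1)+(u2) with limits `𝒱M∞`, `𝒲M∞`: if the covariant-Gram, N-side and comb-FP torus functionals
`b k`, `c k`, `e k` converge to `B`, `C`, `E` and the per-torus identity `hessT(M-side at k, WITH THE k-TH TABLES) + b k = c k + 2·e k` holds for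
all large `k`, then `hessKer G_M 𝒱M∞ 𝒲M∞ μ ν z + B = C + 2·E` AT THE LIMIT FAMILIES.  (The END (B6) «A1-PACKED» calls: the per-torus identity of
(B3) is exact with the p-dependent second tables; `c k → C` is §2's `tendsto_hessT_NlegRoad_of_uniform` when the N tables move too; `KCombine`
§5's `hessKer_transfer_road_limits` is the NON-covariant organisation's analogue.) -/
theorem hessKer_transfer_road_cov_limits_of_uniform {d n : ℕ} [NeZero n] {r : Fin (d + 1) → ℕ} (hr : r ∈ box (d + 1) n)
    (𝒱M : ℕ → Fin (d + 1) → (Fin (d + 1) → ℤ) → MKer (d + 1) (Fib d))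
    (𝒲M : ℕ → Fin (d + 1) → (Fin (d + 1) → ℤ) → Fin (d + 1) → (Fin (d + 1) → ℤ) → MKer (d + 1) (Fib d))
    (𝒱Minf : Fin (d + 1) → (Fin (d + 1) → ℤ) → MKer (d + 1) (Fib d))
    (𝒲Minf : Fin (d + 1) → (Fin (d + 1) → ℤ) → Fin (d + 1) → (Fin (d + 1) → ℤ) → MKer (d + 1) (Fib d))
    (μ ν : Fin (d + 1)) (z : Fin (d + 1) → ℤ) {PM PM' QM QM' : Fin (d + 1) → ℤ} {CvM CvM' CM δM : ℝ}
    (hVM : ∀ k, BiLoc (𝒱M k μ 0) PM PM' CvM δM) (hVM' : ∀ k, BiLoc (𝒱M k ν z) QM' QM CvM' δM)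
    (hWM : ∀ k, BiLoc (𝒲M k μ 0 ν z) PM QM CM δM) (hδM : 0 < δM)
    (hlimVM : ∀ x y a b, Tendsto (fun k => 𝒱M k μ 0 x y a b) atTop (𝓝 (𝒱Minf μ 0 x y a b)))
    (hlimVM' : ∀ x y a b, Tendsto (fun k => 𝒱M k ν z x y a b) atTop (𝓝 (𝒱Minf ν z x y a b)))
    (hlimWM : ∀ x y a b, Tendsto (fun k => 𝒲M k μ 0 ν z x y a b) atTop (𝓝 (𝒲Minf μ 0 ν z x y a b)))
    {p : ℕ → ℕ} [∀ k, NeZero (p k)] (hp : Tendsto p atTop atTop)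
    {b c e : ℕ → ℝ} {B C E : ℝ}
    (hb : Tendsto b atTop (𝓝 B)) (hc : Tendsto c atTop (𝓝 C)) (he : Tendsto e atTop (𝓝 E))
    (hId : ∀ᶠ k in atTop,
      hessT (blocksHat (p k) (sortK n (coDressKBmAt (toSite r) n (KInvStep (d := d) n 0))))
          (blocksHat (p k) (sortK n (arr (n * p k) (𝒱M k μ 0))))
          (blocksHat (p k) (sortK n (arr (n * p k) (𝒱M k ν z))))
          (blocksHat (p k) (sortK n (arr (n * p k) (𝒲M k μ 0 ν z))))
        + b k = c k + 2 * e k) :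
    hessKer (coDressKBmAt (toSite r) n (KInvStep (d := d) n 0)) 𝒱Minf 𝒲Minf μ ν z + B = C + 2 * E :=
  eq_of_tendsto_identity₄_eventually hId
    (tendsto_hessT_coDressKInvStep_of_uniform (d := d) hr 𝒱M 𝒲M 𝒱Minf 𝒲Minf μ ν z hVM hVM' hWM hδM hlimVM hlimVM' hlimWM hp) hb hc he

/-! ## §4 The two tower-slot legs for k-indexed families (twins of `KGhostLeg.tendsto_hessT_Cgh`, `KCombineCovCombLeg.tendsto_hessT_Gtau`) -/

/-- [folklore] **THE «GRAM-COV» SLOT'S LEG FOR k-INDEXED WORD FAMILIES**: for the composite ghost leg `Cgh n a` (`decays_Cgh`, `deltaCgh_pos`,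
`Cgh_imageShift_mul` BY NAME) and k-indexed word families `𝒱 k`, `𝒲 k` under (u1)+(u2), along the road's tori `Site 4 (n·p k)`:
`hessT (Cgh n a)^ (arr (𝒱 k μ 0))^ (arr (𝒱 k ν z))^ (arr (𝒲 k μ 0 ν z))^ → hessKer (Cgh n a) 𝒱∞ 𝒲∞ μ ν z`
(`TorusArrayLimitUniform.tendsto_hessT_hessKer_of_uniform` at the leg's sockets — the pattern of `TorusScalarCoarseLimit` at `CsqK`). -/
theorem tendsto_hessT_Cgh_of_uniform (n : ℕ) [NeZero n] (a : ℝ) (ha : 0 < a)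
    (𝒱 : ℕ → Fin 4 → (Fin 4 → ℤ) → MKer 4 Unit) (𝒲 : ℕ → Fin 4 → (Fin 4 → ℤ) → Fin 4 → (Fin 4 → ℤ) → MKer 4 Unit)
    (𝒱inf : Fin 4 → (Fin 4 → ℤ) → MKer 4 Unit) (𝒲inf : Fin 4 → (Fin 4 → ℤ) → Fin 4 → (Fin 4 → ℤ) → MKer 4 Unit)
    (μ ν : Fin 4) (z : Fin 4 → ℤ) {P P' Q Q' : Fin 4 → ℤ} {C Cv Cv' δ : ℝ}
    (hV : ∀ k, BiLoc (𝒱 k μ 0) P P' Cv δ) (hV' : ∀ k, BiLoc (𝒱 k ν z) Q' Q Cv' δ) (hW : ∀ k, BiLoc (𝒲 k μ 0 ν z) P Q C δ) (hδ : 0 < δ)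
    (hlimV : ∀ x y u v, Tendsto (fun k => 𝒱 k μ 0 x y u v) atTop (𝓝 (𝒱inf μ 0 x y u v)))
    (hlimV' : ∀ x y u v, Tendsto (fun k => 𝒱 k ν z x y u v) atTop (𝓝 (𝒱inf ν z x y u v)))
    (hlimW : ∀ x y u v, Tendsto (fun k => 𝒲 k μ 0 ν z x y u v) atTop (𝓝 (𝒲inf μ 0 ν z x y u v)))
    {p : ℕ → ℕ} [∀ k, NeZero (p k)] (hp : Tendsto p atTop atTop) :
    Tendsto (fun k => hessT (Matrix.of (periodiseF (n * p k) (toF (Cgh n a))))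
        (Matrix.of (periodiseF (n * p k) (toF (arr (n * p k) (𝒱 k μ 0)))))
        (Matrix.of (periodiseF (n * p k) (toF (arr (n * p k) (𝒱 k ν z)))))
        (Matrix.of (periodiseF (n * p k) (toF (arr (n * p k) (𝒲 k μ 0 ν z))))))
      atTop (𝓝 (hessKer (Cgh n a) 𝒱inf 𝒲inf μ ν z)) := by
  obtain ⟨CA, hdec⟩ := decays_Cgh n a ha
  exact tendsto_hessT_hessKer_of_uniform (σ := fun k => n * p k) hdec (deltaCgh_pos n a ha) (Cgh_imageShift_mul n a ha) 𝒱 𝒲 𝒱inf 𝒲inf μ ν z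
    hV hV' hW hδ hlimV hlimV' hlimW (tendsto_mul_period n hp)

/-- [folklore] **THE «COMB-FP» SLOT'S LEG FOR k-INDEXED WORD FAMILIES**: at the identity leg `idK1` (`decays_idK1`, `idK1_imageShift` BY NAME), block
`m + 1`, k-indexed scalar word families `𝒳τ k`, `𝒳τ₂ k` under (u1)+(u2):
`hessT (idK1)^ (arr (𝒳τ k μ 0))^ (arr (𝒳τ k ν z))^ (arr (𝒳τ₂ k μ 0 ν z))^ → hessKer idK1 𝒳τ∞ 𝒳τ₂∞ μ ν z` along `Site 4 ((m+1)·p k)`. -/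
theorem tendsto_hessT_Gtau_of_uniform (m : ℕ) (𝒳τ : ℕ → Fin 4 → (Fin 4 → ℤ) → MKer 4 Unit)
    (𝒳τ₂ : ℕ → Fin 4 → (Fin 4 → ℤ) → Fin 4 → (Fin 4 → ℤ) → MKer 4 Unit) (𝒳τinf : Fin 4 → (Fin 4 → ℤ) → MKer 4 Unit)
    (𝒳τ₂inf : Fin 4 → (Fin 4 → ℤ) → Fin 4 → (Fin 4 → ℤ) → MKer 4 Unit)
    (μ ν : Fin 4) (z : Fin 4 → ℤ) {P P' Q Q' : Fin 4 → ℤ} {C Cv Cv' δ : ℝ}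
    (hV : ∀ k, BiLoc (𝒳τ k μ 0) P P' Cv δ) (hV' : ∀ k, BiLoc (𝒳τ k ν z) Q' Q Cv' δ) (hW : ∀ k, BiLoc (𝒳τ₂ k μ 0 ν z) P Q C δ) (hδ : 0 < δ)
    (hlimV : ∀ x y u v, Tendsto (fun k => 𝒳τ k μ 0 x y u v) atTop (𝓝 (𝒳τinf μ 0 x y u v)))
    (hlimV' : ∀ x y u v, Tendsto (fun k => 𝒳τ k ν z x y u v) atTop (𝓝 (𝒳τinf ν z x y u v)))
    (hlimW : ∀ x y u v, Tendsto (fun k => 𝒳τ₂ k μ 0 ν z x y u v) atTop (𝓝 (𝒳τ₂inf μ 0 ν z x y u v)))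
    {p : ℕ → ℕ} [∀ k, NeZero (p k)] (hp : Tendsto p atTop atTop) :
    Tendsto (fun k => hessT (Matrix.of (periodiseF ((m + 1) * p k) (toF idK1)))
        (Matrix.of (periodiseF ((m + 1) * p k) (toF (arr ((m + 1) * p k) (𝒳τ k μ 0)))))
        (Matrix.of (periodiseF ((m + 1) * p k) (toF (arr ((m + 1) * p k) (𝒳τ k ν z)))))
        (Matrix.of (periodiseF ((m + 1) * p k) (toF (arr ((m + 1) * p k) (𝒳τ₂ k μ 0 ν z)))))) atTop
      (𝓝 (hessKer idK1 𝒳τinf 𝒳τ₂inf μ ν z)) :=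
  tendsto_hessT_hessKer_of_uniform (σ := fun k => (m + 1) * p k) (decays_idK1 1) one_pos (fun _ x y t a b => idK1_imageShift _ x y t a b)
    𝒳τ 𝒳τ₂ 𝒳τinf 𝒳τ₂inf μ ν z hV hV' hW hδ hlimV hlimV' hlimW (tendsto_mul_period (m + 1) hp)

end Summit.QuantumFields.BalabanUV.Beta.D1BFx.MovingTableSockets

end
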